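import Summits.CriticalPhenomena.Ising3DConformalLimit.Theorems.PerfectScreeningGaussianLimitNotScreenedRieszBalayage
import Summits.CriticalPhenomena.Ising3DConformalLimit.Theorems.PerfectScreeningGaussianLimitNotScreenedRieszKernelPosDef
import Summits.CriticalPhenomena.Ising3DConformalLimit.Theorems.PerfectScreeningGaussianLimitNotScreenedRegressionDefs
import HarnessLib

/-!
# Crux `GaussianLimitNotScreened` (stmt-CriticalPhenomena-13886), line `single-layer-linear-regression`:
# the RIESZ BALAYAGE BOUND `Q_Δ(φ) ≤ 1 − Δ` (the planner's stub C, recomposed)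

THEOREM-ONLY file. The planner's registered stub C `stub_rieszBalayageBound` — for `Δ ∈ [1/2, 1)` and every
continuous profile `φ` supported in a ball, `Q_Δ(φ) = 2∫φ(v)(1+|v|²)^{−Δ}dv − ∫∫φ(v)φ(w)|v−w|^{−2Δ} ≤ 1 − Δ` — is
now a THEOREM: lead c1's glue `rieszBalayageBound_of_stubs` (moved here verbatim) fed with the LANDED C1
`stub_rieszKernelPosDef` (positive-semidefiniteness of the Riesz kernel on `ℝ²`, p126364) and C2 `stub_rieszBalayage`
(M. Riesz' balayage identity onto a plane and its mass, p125408). Certificate: `ψ_Δ = ((1−Δ)/π)(1+|·|²)^{Δ−2}` has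
`Kψ_Δ = p₁ := (1+|·|²)^{−Δ}` and `⟨ψ_Δ, p₁⟩ = 1 − Δ`, so `Q_Δ(φ) = 2⟨φ,Kψ_Δ⟩ − ⟨φ,Kφ⟩ ≤ ⟨ψ_Δ,Kψ_Δ⟩ = 1 − Δ`.

References: N. S. Landkof, *Foundations of Modern Potential Theory* (1972), Ch. IV §5; M. Riesz (1938).
-/

noncomputable section

namespace Summit.CriticalPhenomena.Ising3DConformalLimit.Cruxes.GaussianLimitNotScreened.SingleLayerLinearRegression

open MeasureTheory Filter Topology
open Literature.Probability.LatticeModels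

/-- **C from C1 + C2** (the planner's `stub_rieszBalayageBound`, now a theorem modulo the two registered
real-analysis stubs): with `ψ_Δ := ((1−Δ)/π)(1+|·|²)^{Δ−2}`, C2 gives `Kψ_Δ = p₁ := (1+|·|²)^{−Δ}` pointwise and
`⟨ψ_Δ,p₁⟩ = 1 − Δ`, so `Q_Δ(φ) = 2⟨φ,p₁⟩ − ⟨φ,Kφ⟩ = 2⟨φ,Kψ_Δ⟩ − ⟨φ,Kφ⟩ ≤ ⟨ψ_Δ,Kψ_Δ⟩ = ⟨ψ_Δ,p₁⟩ = 1 − Δ` by C1.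
[cite: Landkof1972, Chapter IV §5] -/
theorem rieszBalayageBound_of_stubs
    (hC1 : ∀ Δ : ℝ, 1 / 2 ≤ Δ → Δ < 1 → ∀ (φ : EuclideanSpace ℝ (Fin 2) → ℝ) (R : ℕ), Continuous φ →
      (∀ v : EuclideanSpace ℝ (Fin 2), (R : ℝ) ≤ ‖v‖ → φ v = 0) →
      ∀ (ψ : EuclideanSpace ℝ (Fin 2) → ℝ) (C : ℝ), Continuous ψ →
      (∀ w : EuclideanSpace ℝ (Fin 2), |ψ w| ≤ C * (1 + ‖w‖ ^ 2) ^ (Δ - 2)) →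
      2 * ∫ v : EuclideanSpace ℝ (Fin 2), ∫ w : EuclideanSpace ℝ (Fin 2),
          φ v * ψ w * ‖v - w‖ ^ (-(2 * Δ)) ≤
        (∫ v : EuclideanSpace ℝ (Fin 2), ∫ w : EuclideanSpace ℝ (Fin 2),
            φ v * φ w * ‖v - w‖ ^ (-(2 * Δ))) +
          ∫ v : EuclideanSpace ℝ (Fin 2), ∫ w : EuclideanSpace ℝ (Fin 2),
            ψ v * ψ w * ‖v - w‖ ^ (-(2 * Δ)))
    (hC2 : ∀ Δ : ℝ, 1 / 2 ≤ Δ → Δ < 1 →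
      (∀ v : EuclideanSpace ℝ (Fin 2), ∫ w : EuclideanSpace ℝ (Fin 2),
          (1 + ‖w‖ ^ 2) ^ (Δ - 2) * ‖v - w‖ ^ (-(2 * Δ)) =
            Real.pi / (1 - Δ) * (1 + ‖v‖ ^ 2) ^ (-Δ)) ∧
      ∫ v : EuclideanSpace ℝ (Fin 2), (1 + ‖v‖ ^ 2) ^ (Δ - 2) * (1 + ‖v‖ ^ 2) ^ (-Δ) = Real.pi) :
    ∀ Δ : ℝ, 1 / 2 ≤ Δ → Δ < 1 → ∀ (φ : E2 → ℝ) (R : ℕ), Continuous φ →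
      (∀ v : E2, (R : ℝ) ≤ ‖v‖ → φ v = 0) → contQ Δ φ ≤ 1 - Δ := by
  intro Δ h₁ h₂ φ R hφc hφs
  obtain ⟨hbal, hmass⟩ := hC2 Δ h₁ h₂
  have h1Δ : 0 < 1 - Δ := by linarith
  have hπ : Real.pi ≠ 0 := Real.pi_pos.ne'
  -- the balayage density and its defining properties
  set c : ℝ := (1 - Δ) / Real.pi with hc
  have hc0 : 0 ≤ c := div_nonneg h1Δ.le Real.pi_pos.le
  set ψ : E2 → ℝ := fun w => c * (1 + ‖w‖ ^ 2) ^ (Δ - 2) with hψ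
  have hbase : ∀ w : E2, 0 < 1 + ‖w‖ ^ 2 := fun w => by positivity
  have hψc : Continuous ψ := by
    refine continuous_const.mul ?_
    exact (continuous_const.add (continuous_norm.pow 2)).rpow_const fun w => Or.inl (hbase w).ne'
  have hψb : ∀ w : E2, |ψ w| ≤ c * (1 + ‖w‖ ^ 2) ^ (Δ - 2) := by
    intro w
    rw [abs_of_nonneg (mul_nonneg hc0 (Real.rpow_nonneg (hbase w).le _))]
  -- `Kψ = p₁` pointwise
  have hKψ : ∀ v : E2, ∫ w : E2, ψ w * ‖v - w‖ ^ (-(2 * Δ)) = (1 + ‖v‖ ^ 2) ^ (-Δ) := by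
    intro v
    have : (fun w : E2 => ψ w * ‖v - w‖ ^ (-(2 * Δ))) =
        fun w : E2 => c * ((1 + ‖w‖ ^ 2) ^ (Δ - 2) * ‖v - w‖ ^ (-(2 * Δ))) := by
      funext w; simp only [hψ]; ring
    rw [this, integral_const_mul, hbal v, hc]
    field_simp
  -- `⟨φ, p₁⟩ = ⟨φ, Kψ⟩`
  have hcross : ∫ v : E2, φ v * (1 + ‖v‖ ^ 2) ^ (-Δ) =
      ∫ v : E2, ∫ w : E2, φ v * ψ w * ‖v - w‖ ^ (-(2 * Δ)) := by
    refine integral_congr_ae (Eventually.of_forall fun v => ?_)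
    have : (fun w : E2 => φ v * ψ w * ‖v - w‖ ^ (-(2 * Δ))) =
        fun w : E2 => φ v * (ψ w * ‖v - w‖ ^ (-(2 * Δ))) := by
      funext w; ring
    simp only [this, integral_const_mul, hKψ v]
  -- `⟨ψ, Kψ⟩ = ⟨ψ, p₁⟩ = 1 − Δ`
  have hself : ∫ v : E2, ∫ w : E2, ψ v * ψ w * ‖v - w‖ ^ (-(2 * Δ)) = 1 - Δ := by
    have hstep : ∀ v : E2, ∫ w : E2, ψ v * ψ w * ‖v - w‖ ^ (-(2 * Δ)) =
        c * ((1 + ‖v‖ ^ 2) ^ (Δ - 2) * (1 + ‖v‖ ^ 2) ^ (-Δ)) := by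
      intro v
      have : (fun w : E2 => ψ v * ψ w * ‖v - w‖ ^ (-(2 * Δ))) =
          fun w : E2 => ψ v * (ψ w * ‖v - w‖ ^ (-(2 * Δ))) := by
        funext w; ring
      rw [this, integral_const_mul, hKψ v, hψ]
      ring
    simp only [hstep, integral_const_mul, hmass, hc]
    field_simp
  -- assemble with C1
  have hpsd := hC1 Δ h₁ h₂ φ R hφc hφs ψ c hψc hψb
  simp only [contQ]
  linarith

/-- **The planner's stub C `stub_rieszBalayageBound` as a THEOREM** (C1 p126364 + C2 p125408 + lead c1's glue):
`Q_Δ(φ) ≤ 1 − Δ` for `Δ ∈ [1/2,1)` and every continuous `φ` vanishing outside a ball.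
[cite: Landkof1972, Chapter IV §5] -/
theorem stub_rieszBalayageBound :
    ∀ Δ : ℝ, 1 / 2 ≤ Δ → Δ < 1 → ∀ (φ : E2 → ℝ) (R : ℕ), Continuous φ →
      (∀ v : E2, (R : ℝ) ≤ ‖v‖ → φ v = 0) → contQ Δ φ ≤ 1 - Δ :=
  rieszBalayageBound_of_stubs stub_rieszKernelPosDef stub_rieszBalayage

end Summit.CriticalPhenomena.Ising3DConformalLimit.Cruxes.GaussianLimitNotScreened.SingleLayerLinearRegression

end
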